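import Literature.AlgebraicGeometry.Resolution.RegularSystemOfParameters
import Mathlib.Algebra.MvPolynomial.Monad
import Mathlib.RingTheory.Filtration
import HarnessLib

/-!
# Crux `Steer` (stmt-ResolutionOfSingularities-16345), chain W4.1: hNT4, part 3 — INITIAL FORMS in a regular local ring
# through a coefficient field map (the graded bookkeeping of bricks T3 / L of res-L0-w41-idea-3's `HNT4-BLUEPRINT.md`;
# Theses-free, def-free)

OURS (campaign `res-hironaka`, rung L ★L-G4, slot W4.1; statements about the route's own objects; NOT statements of the
manuscript under review [claim: Hironaka2017, status: under-review]; AI review is weaker than expert review). Seat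
res-D-pv-004 (AS res-L0-w41-stub-10), hNT4 STAGE 2.

For a regular local ring `A` with regular system of parameters `v = (v₁, …, v_r)` and a ring homomorphism `θ : k → A` from a
FIELD hitting every residue class (`∀ a, ∃ c, a − θ c ∈ 𝔫`; in the application `A = S_(m+1)/(x_m)` and `θ` = constants
of the chart map at a RATIONAL centre), `gr_𝔫(A) = k[X₁, …, X_r]` degree by degree, in elementary terms:

* `exists_isHomogeneous_map_coeff_sub_mem` / `eval_sub_eval_map_mem_pow_succ` — every `n`-form over `A` is, coefficientwise
  modulo `𝔫`, the image of an `n`-form over `k`; hence their values at `v` agree modulo `𝔫^(n+1)`;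
* `exists_isHomogeneous_sub_eval_map_mem_pow_succ` — every `z ∈ 𝔫^n` is `G(v) mod 𝔫^(n+1)` for an `n`-form `G` over `k`
  (its INITIAL FORM);
* `eq_of_eval_map_sub_eval_map_mem_pow_succ` — uniqueness: two `n`-forms over `k` with the same value at `v` modulo
  `𝔫^(n+1)` are EQUAL (quasi-regularity of `v`, Matsumura Thm. 17.10, tree `coeff_mem_maximalIdeal_of_eval_mem_pow`);
* `coeff_bind₁_sub_bind₁_mem` — substituting coefficientwise-congruent families gives coefficientwise-congruent results;
* `mem_pow_of_sq_mem_pow` — ORDER OF SQUARES: `s² ∈ 𝔫^(2e) ⇒ s ∈ 𝔫^e` (the initial form of `s²` is the square of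
  that of `s`, and `κ(A)[X]` is reduced).

No Theses file is imported; nothing here is a route item or a registration. [cite: Matsumura1987, Thm. 17.10]
-/

noncomputable section

-- `Summit.<S>.<S>.…` duplicates the summit name by design (single-problem summit).
set_option linter.dupNamespace false

open IsLocalRing MvPolynomial

namespace Summit.ResolutionOfSingularities.ResolutionOfSingularities.Theorems.SwitchingDichotomy.NoTangentialStep

open Literature.AlgebraicGeometry.Resolution

/-! ## Coefficient reduction along `θ : k → A` -/
section Reduction

variable {A : Type*} [CommRing A] {k : Type*} [CommRing k] (θ : k →+* A) (I : Ideal A)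

/-- **Coefficient reduction**: if `θ : k → A` hits every class modulo the ideal `I`, every `n`-form `F` over `A` is
congruent coefficientwise modulo `I` to `θ(G)` for an `n`-form `G` over `k`. OURS. [folklore] -/
theorem exists_isHomogeneous_map_coeff_sub_mem (hθ : ∀ a : A, ∃ c : k, a - θ c ∈ I) {σ : Type*}
    (F : MvPolynomial σ A) {n : ℕ} (hF : F.IsHomogeneous n) :
    ∃ G : MvPolynomial σ k, G.IsHomogeneous n ∧ ∀ m, (F - MvPolynomial.map θ G).coeff m ∈ I := by
  classical
  choose c hc using hθ
  refine ⟨∑ m ∈ F.support, monomial m (c (F.coeff m)), ?_, fun m => ?_⟩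
  · refine IsHomogeneous.sum _ _ _ fun m hm => isHomogeneous_monomial _ ?_
    rw [Finsupp.degree_eq_weight_one]
    exact hF (mem_support_iff.mp hm)
  · rw [coeff_sub, coeff_map, coeff_sum]
    simp only [coeff_monomial, Finset.sum_ite_eq', mem_support_iff, ne_eq, ite_not]
    by_cases h0 : F.coeff m = 0
    · simp [h0]
    · simp only [h0, ↓reduceIte]
      exact hc _

variable {r : ℕ} (v : Fin r → A)

/-- A form of degree `n` whose coefficients lie in `I` takes at `v` a value in `I · (v)^n`. OURS. [folklore] -/
theorem eval_mem_mul_pow_of_coeff_mem {F : MvPolynomial (Fin r) A} {n : ℕ} (hF : F.IsHomogeneous n)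
    (hc : ∀ m, F.coeff m ∈ I) : eval v F ∈ I * Ideal.span (Set.range v) ^ n :=
  eval_mem_mul_span_pow v hF ((mem_map_C_iff).mpr hc)

/-- **Coefficient reduction, evaluated**: with `(v) = I`, an `n`-form `F` over `A` and the `n`-form `G` over `k` of
`exists_isHomogeneous_map_coeff_sub_mem` satisfy `F(v) − θ(G)(v) ∈ I^(n+1)`. OURS. [folklore] -/
theorem eval_sub_eval_map_mem_pow_succ (hv : Ideal.span (Set.range v) = I)
    (hθ : ∀ a : A, ∃ c : k, a - θ c ∈ I) (F : MvPolynomial (Fin r) A) {n : ℕ} (hF : F.IsHomogeneous n) :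
    ∃ G : MvPolynomial (Fin r) k, G.IsHomogeneous n ∧ eval v F - eval v (MvPolynomial.map θ G) ∈ I ^ (n + 1) := by
  obtain ⟨G, hG, hcoeff⟩ := exists_isHomogeneous_map_coeff_sub_mem θ I hθ F hF
  refine ⟨G, hG, ?_⟩
  have h := eval_mem_mul_pow_of_coeff_mem I v (hF.sub (hG.map θ)) hcoeff
  rw [map_sub, hv, ← pow_succ'] at h
  exact h

/-- **Initial forms**: with `(v) = I` and `θ` hitting every class modulo `I`, every `z ∈ I^n` is `θ(G)(v)` modulo
`I^(n+1)` for an `n`-form `G` over `k`. OURS. [folklore] -/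
theorem exists_isHomogeneous_sub_eval_map_mem_pow_succ (hv : Ideal.span (Set.range v) = I)
    (hθ : ∀ a : A, ∃ c : k, a - θ c ∈ I) {n : ℕ} {z : A} (hz : z ∈ I ^ n) :
    ∃ G : MvPolynomial (Fin r) k, G.IsHomogeneous n ∧ z - eval v (MvPolynomial.map θ G) ∈ I ^ (n + 1) := by
  rw [← hv] at hz
  obtain ⟨F, hF, rfl⟩ := exists_isHomogeneous_of_mem_span_pow v n hz
  exact eval_sub_eval_map_mem_pow_succ θ I v hv hθ F hF

/-- **Substitution respects coefficientwise congruence**: if the families `Λ`, `Λ'` of polynomials over `A` agree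
coefficientwise modulo `I`, then so do `P(Λ)` and `P(Λ')` for every polynomial `P` over `A`. OURS. [folklore] -/
theorem coeff_bind₁_sub_bind₁_mem {σ τ : Type*} (Λ Λ' : σ → MvPolynomial τ A)
    (hΛ : ∀ i m, (Λ i - Λ' i).coeff m ∈ I) (P : MvPolynomial σ A) (m : τ →₀ ℕ) :
    (bind₁ Λ P - bind₁ Λ' P).coeff m ∈ I := by
  have key : MvPolynomial.map (Ideal.Quotient.mk I) (bind₁ Λ P) =
      MvPolynomial.map (Ideal.Quotient.mk I) (bind₁ Λ' P) := by
    rw [map_bind₁, map_bind₁]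
    have hfun : (fun i => MvPolynomial.map (Ideal.Quotient.mk I) (Λ i)) =
        fun i => MvPolynomial.map (Ideal.Quotient.mk I) (Λ' i) := by
      funext i
      ext m'
      rw [coeff_map, coeff_map, Ideal.Quotient.eq, ← coeff_sub]
      exact hΛ i m'
    rw [hfun]
  have h := congrArg (coeff m) key
  rw [coeff_map, coeff_map, Ideal.Quotient.eq, ← coeff_sub] at h
  exact h

end Reduction

/-! ## Uniqueness of initial forms and the order of a square (regular local rings) -/
section Regular

variable {A : Type*} [CommRing A] [IsRegularLocalRing A] {r : ℕ} (hd : (maximalIdeal A).spanFinrank = r)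
  (v : Fin r → A) (hv : Ideal.span (Set.range v) = maximalIdeal A)

include hd hv in
/-- **Uniqueness of initial forms** (quasi-regularity of a regular system of parameters, Matsumura Thm. 17.10): for a ring
homomorphism `θ : k → A` from a FIELD and two `n`-forms `F, G` over `k`, if `θ(F)(v) ≡ θ(G)(v) mod 𝔫^(n+1)` then `F = G`
— the coefficients of `θ(F − G)` lie in `𝔫`, and `θ` of a nonzero field element is a unit. OURS.
[cite: Matsumura1987, Thm. 17.10] -/
theorem eq_of_eval_map_sub_eval_map_mem_pow_succ {k : Type*} [Field k] (θ : k →+* A) {n : ℕ}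
    {F G : MvPolynomial (Fin r) k} (hF : F.IsHomogeneous n) (hG : G.IsHomogeneous n)
    (h : eval v (MvPolynomial.map θ F) - eval v (MvPolynomial.map θ G) ∈ maximalIdeal A ^ (n + 1)) : F = G := by
  rw [← sub_eq_zero]
  ext m
  rw [coeff_zero]
  by_contra hm
  have hH : (MvPolynomial.map θ (F - G)).IsHomogeneous n := (hF.sub hG).map θ
  have hev : eval v (MvPolynomial.map θ (F - G)) ∈ maximalIdeal A ^ (n + 1) := by
    rwa [map_sub, map_sub]
  have hc := coeff_mem_maximalIdeal_of_eval_mem_pow hd v hv hH hev m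
  rw [coeff_map] at hc
  exact hc ((IsUnit.mk0 _ hm).map θ)

include hd hv in
/-- **The order of a square** in a regular local ring: `s² ∈ 𝔫^(2e) ⇒ s ∈ 𝔫^e`. (If `s ∈ 𝔫^j ∖ 𝔫^(j+1)` with `j < e`,
write `s = P(v)` for a `j`-form `P` with a unit coefficient; then `s² = P²(v) ∈ 𝔫^(2j+1)` forces all coefficients of
`P²` into `𝔫` (Matsumura 17.10), i.e. `P̄² = 0` in `κ(A)[X]`, so `P̄ = 0` — a contradiction. Krull's intersection theorem
provides `j`.) OURS. [cite: Matsumura1987, Thm. 17.10] -/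
theorem mem_pow_of_sq_mem_pow (e : ℕ) {s : A} (hs : s ^ 2 ∈ maximalIdeal A ^ (2 * e)) : s ∈ maximalIdeal A ^ e := by
  classical
  by_contra hnot
  -- the exact order `j < e` of `s`
  have hex : ∃ j, s ∉ maximalIdeal A ^ (j + 1) := ⟨e - 1, by
    have : e - 1 + 1 = e := by
      rcases Nat.eq_zero_or_pos e with h | h
      · exfalso; rw [h, pow_zero, Ideal.one_eq_top] at hnot; exact hnot Submodule.mem_top
      · omega
    rwa [this]⟩
  let j := Nat.find hex
  have hj : s ∉ maximalIdeal A ^ (j + 1) := Nat.find_spec hex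
  have hjmem : s ∈ maximalIdeal A ^ j := by
    rcases Nat.eq_zero_or_pos j with h0 | hpos
    · rw [h0, pow_zero, Ideal.one_eq_top]; exact Submodule.mem_top
    · have := Nat.find_min hex (m := j - 1) (by omega)
      push Not at this
      have hj1 : j - 1 + 1 = j := by omega
      rwa [hj1] at this
  have hje : j < e := by
    by_contra hge
    push Not at hge
    exact hnot (Ideal.pow_le_pow_right hge hjmem)
  -- `s = P(v)`, `P` a `j`-form
  rw [← hv] at hjmem
  obtain ⟨P, hP, hPs⟩ := exists_isHomogeneous_of_mem_span_pow v j hjmem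
  -- `s² = P²(v) ∈ 𝔫^(2j+1)`: all coefficients of `P²` lie in `𝔫`
  have hP2 : (P ^ 2).IsHomogeneous (j * 2) := hP.pow 2
  have hs2 : eval v (P ^ 2) ∈ maximalIdeal A ^ (j * 2 + 1) := by
    rw [map_pow, hPs]
    exact Ideal.pow_le_pow_right (by omega) hs
  have hcoeff : ∀ m, (P ^ 2).coeff m ∈ maximalIdeal A := coeff_mem_maximalIdeal_of_eval_mem_pow hd v hv hP2 hs2
  -- hence `P̄² = 0` in `κ(A)[X]`, so `P̄ = 0`
  have hbar2 : MvPolynomial.map (residue A) (P ^ 2) = 0 := by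
    ext m
    rw [coeff_map, coeff_zero, residue_eq_zero_iff]
    exact hcoeff m
  have hbar : MvPolynomial.map (residue A) P = 0 := by
    rw [map_pow] at hbar2
    exact pow_eq_zero_iff (n := 2) (by norm_num) |>.mp hbar2
  -- so all coefficients of `P` lie in `𝔫` and `s = P(v) ∈ 𝔫^(j+1)`
  have hcoeffP : ∀ m, P.coeff m ∈ maximalIdeal A := fun m => by
    have := congrArg (coeff m) hbar
    rwa [coeff_map, coeff_zero, residue_eq_zero_iff] at this
  apply hj
  have h := eval_mem_mul_span_pow v hP ((mem_map_C_iff).mpr hcoeffP)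
  rw [hPs, hv, ← pow_succ'] at h
  exact h

end Regular

end Summit.ResolutionOfSingularities.ResolutionOfSingularities.Theorems.SwitchingDichotomy.NoTangentialStep

end
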